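import Summits.ValiantsHypothesis.ValiantsHypothesis.Theorems.LacunarySymmetroidMatrixDescartesPivotBilinearAll
import Summits.ValiantsHypothesis.ValiantsHypothesis.Theorems.LacunarySymmetroidMatrixDescartesCensusPivotResolventDescartes

/-!
# `MatrixDescartes` (stmt-ValiantsHypothesis-18050) — THE INDEX-ONE PIVOT COLUMN AT EVERY FORMAT, AS IT STANDS:
# `2(m−1)(K−1) + 2 ≤ Z₊^max(m, K)₁ ≤ 2·C(K+m−1, m−1)`

HONEST FRAMING.  Cell `pub-symmetroid`, seat `val-sym-mdr-p2` (gen 24); helper file `--supports` the crux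
`Theses.LacunarySymmetroid.MatrixDescartes` (OPEN), NO closure claim.  One citable bracket for conjb-1's index-one pivot column
(`…CensusPivotDefs`) at EVERY format `(m, K)` with `m ≥ 1`, `K ≥ 2`, assembled from the tree: the LOWER end is the stacked
pole-weaving family (`not_pivotRootLawAt_bilinear`, this seat), the UPPER end the resolvent–Descartes count
(`rankOneResolventDescartes_holds`, seat g3 on conjb-1 g1's claim); at `m = 2` the upper end sharpens to `2K + 2` (R1₂,
`…PivotStaircaseAllK.two_indexOne_row_pinned`).  Between the two ends every explicit rung of the column (R1″ `2m(K+1)`, R1‴b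
`2(m−1)K + 2`, R1‴ `2(m−1)(K−1) + 2` = the lower end itself, `DiagonalRankOneLaw`, R1′, PIL′, PIL_K) is OPEN; R1 and PIL are refuted.
Nothing here bears on `MatrixDescartes` in its window, on `DoorA26`/`DoorA34`, on the registers, or on `VP ≠ VNP`.
[folklore] Bookkeeping over the tree.
-/

set_option linter.dupNamespace false

namespace Summit.ValiantsHypothesis.ValiantsHypothesis.Theorems.LacunarySymmetroidMatrixDescartes.Pivot

/-- **The index-one column bracket at every format** (`m ≥ 1`, `K ≥ 2`): any valid row has budget `≥ 2(m−1)(K−1) + 2`, and the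
row with budget `2·C(K+m−1, m−1)` is valid. -/
theorem indexOne_column_bracket (m K : ℕ) (hm : 1 ≤ m) (hK : 2 ≤ K) :
    (∀ B, PivotRootLawAt m K 1 B → 2 * (m - 1) * (K - 1) + 2 ≤ B) ∧
      PivotRootLawAt m K 1 (2 * Nat.choose (K + m - 1) (m - 1)) :=
  ⟨fun _ h => le_of_pivotRootLawAt_indexOne hm hK h, rankOneResolventDescartes_holds m K⟩

/-- The bracket is consistent: `2(m−1)(K−1) + 2 ≤ 2·C(K+m−1, m−1)` for `m ≥ 1`, `K ≥ 2` (a law with a smaller budget than an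
attained count would be contradictory; recorded as a sanity check of the two tree theorems against each other). -/
theorem bilinear_le_resolvent (m K : ℕ) (hm : 1 ≤ m) (hK : 2 ≤ K) :
    2 * (m - 1) * (K - 1) + 2 ≤ 2 * Nat.choose (K + m - 1) (m - 1) :=
  (indexOne_column_bracket m K hm hK).1 _ (indexOne_column_bracket m K hm hK).2

end Summit.ValiantsHypothesis.ValiantsHypothesis.Theorems.LacunarySymmetroidMatrixDescartes.Pivot
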